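import Literature.Analysis.FluidPDE.StationaryEulerSubsolutions
import Literature.Analysis.FluidPDE.StationaryEulerRelaxationHighDim
import Literature.Analysis.FluidPDE.Antidivergence
import HarnessLib

/-!
# Route TaylorCertificates — support `ForcedStandingFlows`: the affine subsolution `(f, ℛf)`

Helper file for the item `stmt-AnomalousDissipation-14031` (`ForcedStandingFlows`). The forced
stationary Euler system `div (v ⊗ v) + ∇p = f`, `div v = 0` relaxes to the affine linear system
`div v = 0`, `div u + ∇q = f` with the pointwise constraint `(v, u)(x) ∈ 𝒦_{e(x)}`; for a smooth
mean-zero force the explicit field `w_f = (f, ℛf)` — `ℛ` the De Lellis–Székelyhidi antidivergence of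
the tree (`Torus.antidivergence`: symmetric, trace free, `div ℛf = f - ∫ f`) — is a smooth
admissible solution of the affine system (`integral_str_forcedState`, integration by parts), and any
continuous admissible field is STRICT (valued in `int 𝒦_E^{co} = HighDim.U E`) for a large
constant energy level `E` (`exists_forall_mem_highDimU`, compactness). Also the test field
`(f, 0)` pairing a state with the work density `⟪v, f⟫`.

## References

* A. Choffrut, L. Székelyhidi Jr., SIAM J. Math. Anal. 46 (2014) = arXiv:1401.4301, §2 (subsolutions), §4 (`int 𝒦^{co}`).
* A. Cheskidov, X. Luo, Invent. Math. 229 (2022), §7.2 Def. 7.2 (the operator `ℛ`). [CheskidovLuo2022]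
-/

noncomputable section

open scoped InnerProductSpace ContDiff ENNReal Topology Matrix
open Set Function MeasureTheory Metric Filter
open Literature.Analysis.FunctionSpaces Literature.Analysis.FluidPDE
open Literature.Analysis.FluidPDE.StationaryEuler

namespace Summit.AnomalousDissipation.AnomalousDissipation.Theorems

-- the mandated namespace `Summit.<Summit>.<Problem>.Theorems` repeats `AnomalousDissipation` (single-problem summit)
set_option linter.dupNamespace false

namespace ForcedFlows

section Subsolution

variable {d : Type*} [Fintype d] [DecidableEq d]

/-- The stress of the affine subsolution: the De Lellis–Székelyhidi antidivergence `ℛf` of the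
force as a matrix field, `(ℛf)ᵢⱼ(x)`. [folklore] -/
def forcedStress (f : UnitAddTorus d → Ed d) (x : UnitAddTorus d) : Matrix d d ℝ :=
  Matrix.of fun i j => Torus.antidivEntry f i j x

/-- The affine subsolution `w_f(x) = (f(x), ℛf(x))` of the forced stationary Euler system
`div v = 0`, `div u + ∇q = f` (for mean-zero `f`: `div ℛf = f`). [folklore] -/
def forcedState (f : UnitAddTorus d → Ed d) (x : UnitAddTorus d) : State d := mkSt (f x) (forcedStress f x)

/-- The state-valued test field `(f(x), 0)`, pairing a state with the work density `⟪v, f⟫`. [folklore] -/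
def velState (f : UnitAddTorus d → Ed d) (x : UnitAddTorus d) : State d := mkSt (f x) 0

/-- Entries of the forced stress. [folklore] -/
@[simp] theorem forcedStress_apply (f : UnitAddTorus d → Ed d) (x : UnitAddTorus d) (i j : d) :
    forcedStress f x i j = Torus.antidivEntry f i j x := rfl

/-- The velocity of the affine subsolution is the force. [folklore] -/
@[simp] theorem vel_forcedState (f : UnitAddTorus d → Ed d) (x : UnitAddTorus d) : vel (forcedState f x) = f x :=
  vel_mkSt _ _

/-- The stress of the affine subsolution. [folklore] -/
@[simp] theorem str_forcedState (f : UnitAddTorus d → Ed d) (x : UnitAddTorus d) :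
    str (forcedState f x) = forcedStress f x :=
  str_mkSt _ _

omit [Fintype d] [DecidableEq d] in
/-- The velocity of the test field `(f, 0)`. [folklore] -/
@[simp] theorem vel_velState (f : UnitAddTorus d → Ed d) (x : UnitAddTorus d) : vel (velState f x) = f x :=
  vel_mkSt _ _

omit [DecidableEq d] in
/-- Pairing a state with `(f, 0)` is pairing its velocity with `f`. [folklore] -/
theorem inner_velState (w : State d) (f : UnitAddTorus d → Ed d) (x : UnitAddTorus d) :
    ⟪w, velState f x⟫_ℝ = ⟪vel w, f x⟫_ℝ := by
  simp only [PiLp.inner_apply, Fintype.sum_sum_type, velState, mkSt_apply_inl, mkSt_apply_inr, Matrix.zero_apply,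
    inner_zero_right, Finset.sum_const_zero, add_zero, vel_apply]

variable {f : UnitAddTorus d → Ed d}

/-- The affine subsolution of a smooth force is smooth. [folklore] -/
theorem isSmooth_forcedState (hf : Torus.IsSmooth f) : Torus.IsSmooth (forcedState f) := by
  refine isSmooth_iff_coord.2 fun c => ?_
  rcases c with i | ⟨i, j⟩
  · have : (fun x => forcedState f x (Sum.inl i)) = fun x => f x i := funext fun x => by
      rw [← vel_apply (forcedState f x) i, vel_forcedState]
    rw [this]; exact hf.apply i
  · have : (fun x => forcedState f x (Sum.inr (i, j))) = fun x => Torus.antidivEntry f i j x :=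
      funext fun x => by rw [← str_apply (forcedState f x) i j, str_forcedState, forcedStress_apply]
    rw [this]; exact Torus.isSmooth_antidivEntry hf i j

omit [DecidableEq d] in
/-- The test field `(f, 0)` of a smooth force is smooth. [folklore] -/
theorem isSmooth_velState (hf : Torus.IsSmooth f) : Torus.IsSmooth (velState f) := by
  refine isSmooth_iff_coord.2 fun c => ?_
  rcases c with i | ⟨i, j⟩
  · have : (fun x => velState f x (Sum.inl i)) = fun x => f x i := funext fun x => by
      rw [← vel_apply (velState f x) i, vel_velState]
    rw [this]; exact hf.apply i
  · have : (fun x => velState f x (Sum.inr (i, j))) = fun _ => (0 : ℝ) := funext fun x => by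
      rw [← str_apply (velState f x) i j]; simp [velState]
    rw [this]; exact Torus.isSmooth_const _

/-- **The affine subsolution is admissible-valued**: `ℛf` is symmetric and trace free (`d ≥ 2`).
[cite: CheskidovLuo2022, §7.2 Def. 7.2] -/
theorem isAdm_forcedState (hd : 2 ≤ Fintype.card d) (hf : Torus.IsSmooth f) (x : UnitAddTorus d) :
    IsAdm (forcedState f x) := by
  refine ⟨?_, ?_⟩
  · rw [str_forcedState]
    refine Matrix.IsSymm.ext fun i j => ?_
    rw [forcedStress_apply, forcedStress_apply]
    have h := Torus.antidivergence_symm hf x i j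
    simp only [Torus.antidivergence_apply] at h
    exact h
  · rw [str_forcedState]
    have h := Torus.antidivergence_trace hd hf x
    simp only [Torus.antidivergence_apply] at h
    simpa [Matrix.trace, Matrix.diag] using h

/-- **The stress identity of the affine subsolution**: `∫ Σᵢⱼ (ℛf)ᵢⱼ ∂ⱼΦᵢ = -∫ Σᵢ (fᵢ - ∫fᵢ) Φᵢ`
for smooth `f`, `Φ` on `T^d`, `d ≥ 2` (integration by parts entry by entry, `div ℛf = f - ∫ f`). [folklore] -/
theorem integral_str_forcedState (hd : 2 ≤ Fintype.card d) (hf : Torus.IsSmooth f) {Φ : UnitAddTorus d → Ed d}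
    (hΦ : Torus.IsSmooth Φ) :
    ∫ x, ∑ i, ∑ j, str (forcedState f x) i j * Torus.partialDeriv j (fun y => Φ y i) x =
      -∫ x, ∑ i, (f x i - (∫ y, f y) i) * Φ x i := by
  have hR : ∀ i j, Torus.IsSmooth (Torus.antidivEntry f i j) := Torus.isSmooth_antidivEntry hf
  have hΦi : ∀ i, Torus.IsSmooth fun y => Φ y i := fun i => hΦ.apply i
  -- the divergence of `ℛf`, coordinatewise
  have hdivR : ∀ x i, ∑ j, Torus.partialDeriv j (Torus.antidivEntry f i j) x = f x i - (∫ y, f y) i := by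
    intro x i
    have h := Torus.tensorDivergence_antidivergence hd hf x
    have hR1 : ∀ j, Torus.IsContDiff 1 (fun y => Torus.antidivergence f y j) := fun j =>
      ((Torus.isSmooth_antidivergence hf).column j).isContDiff (by simp)
    have hi := congrArg (fun v : Ed d => v i) h
    simp only [Torus.tensorDivergence, WithLp.ofLp_sum, Finset.sum_apply, WithLp.ofLp_sub, Pi.sub_apply] at hi
    rw [← hi]
    refine Finset.sum_congr rfl fun j _ => ?_
    rw [← Torus.partialDeriv_apply_coord (hR1 j) j x i]
    rfl
  set A : UnitAddTorus d → ℝ := fun x => ∑ i, ∑ j, Torus.antidivEntry f i j x * Torus.partialDeriv j (fun y => Φ y i) x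
    with hA
  set B : UnitAddTorus d → ℝ := fun x => ∑ i, ∑ j, Torus.partialDeriv j (Torus.antidivEntry f i j) x * Φ x i with hB
  have hAs : Torus.IsSmooth A :=
    isSmooth_finsetSum _ fun i _ => isSmooth_finsetSum _ fun j _ => isSmooth_mul' (hR i j) ((hΦi i).partialDeriv j)
  have hBs : Torus.IsSmooth B :=
    isSmooth_finsetSum _ fun i _ => isSmooth_finsetSum _ fun j _ => isSmooth_mul' ((hR i j).partialDeriv j) (hΦi i)
  have hPs : ∀ i j, Torus.IsSmooth fun y => Torus.antidivEntry f i j y * Φ y i := fun i j => isSmooth_mul' (hR i j) (hΦi i)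
  have hAB : ∫ x, (A x + B x) = 0 := by
    have hprod : ∀ x, A x + B x =
        ∑ i, ∑ j, Torus.partialDeriv j (fun y => Torus.antidivEntry f i j y * Φ y i) x := by
      intro x
      simp only [hA, hB, ← Finset.sum_add_distrib]
      refine Finset.sum_congr rfl fun i _ => Finset.sum_congr rfl fun j _ => ?_
      rw [Torus.partialDeriv_mul ((hR i j).isContDiff (by simp)) ((hΦi i).isContDiff (by simp))]
    rw [integral_congr_ae (Eventually.of_forall hprod)]
    rw [integral_finsetSum _ fun i _ => integrable_finsetSum _ fun j _ => ((hPs i j).partialDeriv j).integrable]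
    refine Finset.sum_eq_zero fun i _ => ?_
    rw [integral_finsetSum _ fun j _ => ((hPs i j).partialDeriv j).integrable]
    exact Finset.sum_eq_zero fun j _ => Torus.integral_partialDeriv_eq_zero_holds (hPs i j) j
  have hBval : ∫ x, B x = ∫ x, ∑ i, (f x i - (∫ y, f y) i) * Φ x i := by
    refine integral_congr_ae (Eventually.of_forall fun x => ?_)
    simp only [hB]
    refine Finset.sum_congr rfl fun i _ => ?_
    rw [← hdivR x i, Finset.sum_mul]
  have hLHS : (fun x => ∑ i, ∑ j, str (forcedState f x) i j * Torus.partialDeriv j (fun y => Φ y i) x) = A := by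
    funext x; simp only [hA, str_forcedState, forcedStress_apply]
  rw [hLHS, ← hBval]
  rw [integral_add hAs.integrable hBs.integrable] at hAB
  linarith

/-- **Strictness for a large constant energy level**: a continuous admissible-valued field on the
torus takes values in `int 𝒦_E^{co}` for some constant `E > 0` (the gap form at level `0` is
bounded below on the compact set `range w × sphere`, and raising the level adds `(E/d)|x|²`). [folklore] -/
theorem exists_forall_mem_highDimU [Nonempty d] {w : UnitAddTorus d → State d} (hw : Continuous w)
    (hadm : ∀ x, IsAdm (w x)) : ∃ E : ℝ, 0 < E ∧ ∀ x, w x ∈ HighDim.U E := by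
  set S : Set (State d × (d → ℝ)) := range w ×ˢ Metric.sphere (0 : d → ℝ) 1 with hS
  have hSc : IsCompact S := (isCompact_range hw).prod (isCompact_sphere _ _)
  have hcont : Continuous fun p : State d × (d → ℝ) => p.2 ⬝ᵥ (gap 0 p.1 *ᵥ p.2) :=
    (HighDim.continuous_gapForm (d := d)).comp ((continuous_const.prodMk continuous_fst).prodMk continuous_snd)
  obtain ⟨x₀⟩ : Nonempty (UnitAddTorus d) := inferInstance
  have h1n : ‖(fun _ : d => (1 : ℝ))‖ = 1 := by
    refine le_antisymm ((pi_norm_le_iff_of_nonneg zero_le_one).2 fun _ => by simp) ?_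
    obtain ⟨i⟩ : Nonempty d := inferInstance
    have h := norm_le_pi_norm (fun _ : d => (1 : ℝ)) i
    rwa [norm_one] at h
  have hSne : S.Nonempty := ⟨(w x₀, fun _ => 1), mem_range_self x₀, mem_sphere_zero_iff_norm.2 h1n⟩
  obtain ⟨p₀, -, hmin⟩ := hSc.exists_isMinOn hSne hcont.continuousOn
  set m : ℝ := p₀.2 ⬝ᵥ (gap 0 p₀.1 *ᵥ p₀.2) with hm
  have hc : (0 : ℝ) < Fintype.card d := by exact_mod_cast Fintype.card_pos
  refine ⟨Fintype.card d * (|m| + 1), by positivity, fun x => ⟨hadm x, (HighDim.forall_pos_iff_sphere _).2 fun y hy => ?_⟩⟩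
  have hmem : (w x, y) ∈ S := ⟨mem_range_self x, by simpa using hy⟩
  have h1 : m ≤ y ⬝ᵥ (gap 0 (w x) *ᵥ y) := hmin hmem
  have hy1 : 1 ≤ ∑ i, y i ^ 2 := by
    by_contra hlt
    push Not at hlt
    have hyi : ∀ i, ‖y i‖ < 1 := fun i => by
      have hi : y i ^ 2 < 1 := lt_of_le_of_lt (Finset.single_le_sum (fun j _ => sq_nonneg (y j)) (Finset.mem_univ i)) hlt
      rw [Real.norm_eq_abs]
      nlinarith [abs_nonneg (y i), sq_abs (y i)]
    have := (pi_norm_lt_iff one_pos).2 hyi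
    linarith
  rw [dotProduct_gap_mulVec_eq_add _ 0, sub_zero, mul_div_cancel_left₀ _ hc.ne']
  nlinarith [neg_abs_le m, abs_nonneg m]

end Subsolution

end ForcedFlows

end Summit.AnomalousDissipation.AnomalousDissipation.Theorems
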